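/-
Copyright (c) 2026 the pub-hodgecm-mathlib formalisation cell (harness21).  Prover seat hodgecm-mathlib-K2E1-p13 (g0), Track B ∕ K2-LIT, h413 = `stmt-HodgeConjecture-24833`,
line `K2_E1_TraceFormulaBeta`, campaign «EIS-RANK-ONE» ∕ R8-LADDER-2, «CLOSER₂ EXPORTS» FILE X1 (dealer K2E1-plan (g6) deals (60)(94)(98)(101); plan of record K2E4-p14 (g7)
`K2/K2E4-p14/g7/HANDOFF-g7-to-g8.K2E4-p14-g7.md` §2 + K2E1-p08 (g6) (a)(b)(c)): THE PER-BALL BERNSTEIN–LAPID PACKAGE of the spherical Eisenstein series of `U(1,1)_{L∕L⁺}`, with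
its objects EXPOSED (test functions, holomorphy set `U`, vector solution `vX`, coefficient `cc`, the `α`-system, and per `g` the evaluation functionals and the scalar piece).
-/
import Summits.HodgeConjecture.HodgeConjecture.Theorems.K2E1SphericalEisensteinMeromorphicU2   -- ★ closer₂ (K2E3-p12 g7) ED. 3: brings EVERY per-ball input (ConvData, ℓ7, S1∕S2, (b1), `hunq_cm_two`, `hK1_cm_two_of`, K2-defs1 (ii), P3-D)
import Summits.HodgeConjecture.HodgeConjecture.Theorems.K2E1BLXSystemByproductsU              -- ★ p859320 (K2E1-p08 g6): `exists_xSystem_byproducts` (U, vX, cc, germs); brings ★ `K2E1BLMeromorphicFamilyByproductsU`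
import Summits.HodgeConjecture.HodgeConjecture.Theorems.K2E1BLLiftIntegrabilityU                -- ★ p859529 (lift brick): `quotFun_lift`, `lift_quotientSubgroup_mul` (the canonical lift `y ↦ v[y⁻¹]`)
import HarnessLib

/-!
# «CLOSER₂ EXPORTS», FILE X1u — `K2E1SphericalEisensteinMeromorphicExportsU2Unique`: the per-ball Bernstein–Lapid package of `U(1,1)_{L∕L⁺}` WITH THE UNIQUENESS CLAUSE

Track B ∕ K2-LIT, crux h413 = `stmt-HodgeConjecture-24833`, route of record `HCCMUnconditional`; cell `hodgecm-mathlib`, squad K2, ENGINE E1.  THEOREMS ONLY (no `def`, no `instance`,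
no `notation`, no `sorry`; default heartbeats); lane `--supports stmt-HodgeConjecture-24833 --as helper` (count-neutral).
WHAT.  ★ closer₂ `sphericalEisenstein_meromorphic_cm_two` (K2E3-p12, letter-free since ED. 3) proves `∃ Ec, meromorphic on ℂ, = E(φ₀H^z)` by running, INSIDE `fun n g`, the per-ball chain
(★ `exists_convData_cm_two` → K2's cusp decay ★ `hK1_cm_two_of` ∘ ★ K2-defs1 (ii) → ★ ℓ7 `exists_constantTermVectors` → ★ (b1)∕S1∕S2 → ★ P6′ `hunq_cm_two` → ★ P3-D → ★ `…_ball_of_letters`) and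
gluing.  The downstream consumers (the operator road ★ p859344∕p859407 `poleControl_continued_cm_two_of_family` ∕ `exists_family_of_operator_letters`, the (RES)∕(L4) payers, T2′) need the
OBJECTS of that chain, which the closer keeps internal.  This file re-runs the g-FREE part of the chain ONCE per ball `D_n = ball 0 (n+2)` (weight `k = n + 3`) and calls ★
`K2E1BLXSystemByproductsU.exists_xSystem_byproducts`, exporting: (R1) the `GL₂`-test functions `η_i` (smooth, `≥ 0`, symmetric, bi-`K`-invariant) and the finite family of test
functions `h_i = S_{η_i} η_i` (continuous, compactly supported, left-`K_U`-invariant, symmetric, real, `Re ≥ 0`) whose height transforms `ĥ_i(z) = ∫ h_i·H^z dν_G` cover the ball; (R3) the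
levels `0 < a`, `1 ≤ κ_i` with the height distortion `H_Z(z) ≤ κ_i·H_Z(z·y)` on `tsupport h_i`; (R2) the convolution operators `T_i = T_X(h_i)` WITH their convolution formula; the open dense
CO-DISCRETE holomorphy set `U ⊆ D_n`; the vector solution `vX : ℂ → 𝓗_k(𝔛)` (holomorphic on `U`, meromorphic on `D_n`, `= [E(φ₀H^z)]` a.e. on `U ∩ {1 < Re}`) with its Hecke eigen-equations
`T_i(vX z) = ĥ_i(z)•vX z`; the coefficient `cc` (holomorphic on `U`) with the `α`-system `cnstN(ι(vX z)) = φ₀•α₁ z + cc z•α₂ z` at level `a` (`α₁ = [H^z]`, `α₂ = [H^{1−z}] ≠ 0`); and (R4),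
for every `g`, the scalar piece `Ec_g`, meromorphic on `D_n`, `= E(φ₀H^z)(g)` on the Godement part, of non-negative order on `U`, and EVENTUALLY EQUAL near every `z ∈ U` with `ĥ_j(z) ≠ 0` to
the germ IN INTEGRAL FORM `s ↦ ĥ_j(s)⁻¹·∫ h_j(y)·vX(s)[(g y)⁻¹] dν_G(y)` (the evaluation functional ★ P3-D `exists_evalCLM` applied to the canonical lift `y ↦ vX(s)[y⁻¹]`, ★ `quotFun_lift`) —
so that consumers bound the germ uniformly on compacts with ★ `exists_bound_evalCLM_of_isCompact` and the exported regularity of `h_j`.  FILE X2 glues (★ `exists_global_pole_set`) and derives (E1)–(E4).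
EDITION NOTE.  This file is ★ X1 `exists_ball_package_cm_two` (p859591) RE-RUN with ONE more exported clause, the Bernstein–Lapid UNIQUENESS of the `𝔛_z`-system on the
holomorphy set `U` (★ `exists_xSystem_byproducts` :93–:94 `huniq`, which X1 dropped): `∀ z ∈ U, ∀ ψ b, (∀ i, T_i ψ = ĥ_i(z)•ψ) → cnst_N(ι ψ) = φ₀•α₁ z + b•α₂ z → ψ = vX z ∧ b = cc z`
— the input of the functional equation `c̃(z)c̃(1−z) = 1` (T2′, [BernsteinLapid2019, §5]).  The proof is X1's, letter for letter, keeping `huniq`.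
* §1 HEAD **`exists_ball_package_unique_cm_two`**.
HONEST LABEL: HC_CM is proved only modulo the 7 printed citations (2 remaining named inputs: hLiu418 = `stmt-HodgeConjecture-24832`, h413 = `stmt-HodgeConjecture-24833`) until rung 0
closes; this file asserts no named fact, closes no socket; count-neutral; letter-free (structural measure data only, as the closer).
[cite: BernsteinLapid2019, Thm 2.3, §2.1, §2.4 and §4 Claims 1–5 (pp. 9–10)] [cite: MoeglinWaldspurger1995, IV.1.8–IV.1.10] [cite: Langlands1976, §7]

## References
* [BernsteinLapid2019] J. Bernstein, E. Lapid, *On the meromorphic continuation of Eisenstein series*, J. AMS 37 (2024), Thm 2.3, §2, §4.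
* [MoeglinWaldspurger1995] C. Mœglin, J.-L. Waldspurger, *Spectral decomposition and Eisenstein series* (1995), IV.1.8–IV.1.10.
* [Langlands1976] R. P. Langlands, *On the Functional Equations Satisfied by Eisenstein Series*, LNM 544 (1976), §7.
-/

set_option autoImplicit false
set_option linter.dupNamespace false  -- the mandated namespace repeats the summit's segment (`HodgeConjecture.HodgeConjecture`)

noncomputable section

open MeasureTheory Filter Topology Set NumberField
open scoped NNReal ENNReal Classical ComplexConjugate
open Literature.MeasureTheory.Group Literature.NumberTheory Literature.NumberTheory.Automorphic Literature.NumberTheory.Automorphic.UnitaryGroup AdelicGroupData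
open Summit.HodgeConjecture.HodgeConjecture.Cruxes.H413.K2E1BorelEisensteinU
open Summit.HodgeConjecture.HodgeConjecture.Cruxes.H413.K2E1BLBorelSpacesU2Defs
open Summit.HodgeConjecture.HodgeConjecture.Cruxes.H413.K2E1BLBorelOperatorsU2Defs
open Summit.HodgeConjecture.HodgeConjecture.Cruxes.H413.K2E1BLIotaClosedEmbeddingU2 (iotaBound_cm isFiniteMeasure_weightedTruncMeasure_cm)
open Summit.HodgeConjecture.HodgeConjecture.Cruxes.H413.K2E1BLQuotientMeasureU (measurePreserving_rightShift_of_unfolding)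
open Summit.HodgeConjecture.HodgeConjecture.Cruxes.H413.K2E1SphericalEisensteinMeromorphicSuppliersU2 (measure_setOf_lt_ne_top_cm)
open Summit.HodgeConjecture.HodgeConjecture.Cruxes.H413.K2E1SphericalEisensteinMeromorphicConvDataCMTwo (exists_convData_cm_two)
open Summit.HodgeConjecture.HodgeConjecture.Cruxes.H413.K2E1BLConstantTermVectorsU2 (exists_constantTermVectors)
open Summit.HodgeConjecture.HodgeConjecture.Cruxes.H413.K2E1BLEisensteinMemHXCMTwo (eisensteinSeriesU_flatSectionU_memHX_cm_two)
open Summit.HodgeConjecture.HodgeConjecture.Cruxes.H413.K2E1SphericalEisensteinSolvesXSystemU2 (shiftOperatorX_toHX_eisensteinSeriesU_eq_smul_cm_two exists_cnstN_iota_toHX_eisensteinSeriesU_eq_cm_two)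
open Summit.HodgeConjecture.HodgeConjecture.Cruxes.H413.K2E1BLFibreAverageInvarianceU (integral_zFun_borelConstantTerm_eq_of_unfolding)
open Summit.HodgeConjecture.HodgeConjecture.Cruxes.H413.K2E1IntertwinedSectionInvariance (map_conj_toAdelic_eq_self_two)
open Summit.HodgeConjecture.HodgeConjecture.Cruxes.H413.K2E1BLUniquenessHunqCM (hunq_cm_two)
open Summit.HodgeConjecture.HodgeConjecture.Cruxes.H413.K2E1BLHomogeneousL2U2 (exists_ae_norm_deltaShift_le_of_ae_eq_cpow)
open Summit.HodgeConjecture.HodgeConjecture.Cruxes.H413.K2E1BLEvaluationFunctionalU2 (exists_evalCLM_eisenstein_cm_two)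
open Summit.HodgeConjecture.HodgeConjecture.Cruxes.H413.K2E1SphericalEisensteinMeromorphicBallU2 (sphericalEisenstein_meromorphicOn_ball_of_letters)
open Summit.HodgeConjecture.HodgeConjecture.Cruxes.H413.K2E1SphericalEisensteinMeromorphicOfBallsU2 (sphericalEisenstein_meromorphic_of_balls)
open Summit.HodgeConjecture.HodgeConjecture.Cruxes.H413.K2E1BLEvaluationFunctionalU2 (exists_evalCLM)
open Summit.HodgeConjecture.HodgeConjecture.Cruxes.H413.K2E1SphericalEisensteinHeckeEigenU2 (hHecke_cm_two)
open Summit.HodgeConjecture.HodgeConjecture.Cruxes.H413.K2E1BLXSystemByproductsU (exists_xSystem_byproducts)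
open Summit.HodgeConjecture.HodgeConjecture.Cruxes.H413.K2E1BLLiftIntegrabilityU (quotFun_lift lift_quotientSubgroup_mul)

namespace Summit.HodgeConjecture.HodgeConjecture.Cruxes.H413.K2E1SphericalEisensteinMeromorphicExportsU2Unique

variable (L : Type) [Field L] [NumberField L] [IsCMField L]
  [MeasurableSpace (quasiSplit (↥(maximalRealSubfield L)) L (IsCMField.complexConj L) 2).Adelic] [BorelSpace (quasiSplit (↥(maximalRealSubfield L)) L (IsCMField.complexConj L) 2).Adelic]

/-- **HEAD — THE PER-BALL BERNSTEIN–LAPID PACKAGE OF `U(1,1)_{L∕L⁺}`, OBJECTS EXPOSED, WITH UNIQUENESS** (module docstring; = ★ X1 + the `huniq` clause inside the `α`-system): for `φ₀ ∈ ℂ` and `n : ℕ` (ball `D_n = ball 0 (n+2)`, weight `k = n+3`),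
`∃ I η h a κ T U vX cc` with the clauses (R1) `η_i`; `h_i = S_{η_i} η_i` and their regularity; the cover `∀ z ∈ D_n, ∃ i, ĥ_i(z) ≠ 0`; (R3) `0 < a`, `1 ≤ κ_i`, height distortion; (R2) the
convolution formula of `T_i`; `U` open, dense, co-discrete in `D_n`; holomorphy∕meromorphy of `vX`, `cc`; Godement agreement of `vX`; Hecke eigen-equations; the `α`-system at level `a`;
(R4) per `g` the scalar piece `Ec_g` with its germs in integral form.  Proof = closer₂ ED. 3's g-free per-ball block ∘ ★ `exists_xSystem_byproducts` ∘ per `g` ★ P3-D `exists_evalCLM`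
(for EVERY `i`) ∘ ★ `hHecke_cm_two` ∘ ★ `quotFun_lift` (integral form). [cite: BernsteinLapid2019, Thm 2.3, §2.1 and §4 Claims 1–5 (pp. 9–10)] [cite: MoeglinWaldspurger1995, IV.1.8–IV.1.10] -/
theorem exists_ball_package_unique_cm_two
    -- structural letters: the measures
    (μ : Measure (quasiSplit (↥(maximalRealSubfield L)) L (IsCMField.complexConj L) 2).automorphicQuotient) [(quasiSplit (↥(maximalRealSubfield L)) L (IsCMField.complexConj L) 2).IsAutomorphicMeasure μ]
    (νG : Measure (quasiSplit (↥(maximalRealSubfield L)) L (IsCMField.complexConj L) 2).Adelic) [νG.IsHaarMeasure] [νG.IsInvInvariant] [SFinite νG]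
    (ν : Measure ↥(adelicUnipotent (↥(maximalRealSubfield L)) L (IsCMField.complexConj L) 2)) [ν.IsHaarMeasure] [ν.IsMulRightInvariant] [ν.IsInvInvariant]
    {𝓕 : Set ↥(adelicUnipotent (↥(maximalRealSubfield L)) L (IsCMField.complexConj L) 2)}
    (h𝓕N : IsFundamentalDomain ↥(rationalUnipotent (↥(maximalRealSubfield L)) L (IsCMField.complexConj L) 2) 𝓕 ν) (h𝓕c : IsCompact (closure 𝓕)) (h𝓕₀ : ν 𝓕 ≠ 0)
    {β : (quasiSplit (↥(maximalRealSubfield L)) L (IsCMField.complexConj L) 2).Adelic → ℝ≥0∞}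
    (hβ : IsCoveringWeight ↥((arithmeticBorel (↥(maximalRealSubfield L)) L (IsCMField.complexConj L) 2).map (quasiSplit (↥(maximalRealSubfield L)) L (IsCMField.complexConj L) 2).arithmeticSubgroup.subtype) β)
    {μZ : Measure (borelQuotient (↥(maximalRealSubfield L)) L (IsCMField.complexConj L) 2)} [SFinite μZ]
    (hμZ : ∀ f : borelQuotient (↥(maximalRealSubfield L)) L (IsCMField.complexConj L) 2 → ℝ≥0∞, Measurable f → ∫⁻ z, f z ∂μZ = ∫⁻ g, β g * f (toBorelQuotient (↥(maximalRealSubfield L)) L (IsCMField.complexConj L) 2 g) ∂νG)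
    (φ₀ : ℂ) (n : ℕ) :
    ∃ (I : Type) (_ : Fintype I) (η : I → GL (Fin 2) (AdeleRing (𝓞 L) L) → ℝ) (h : I → (quasiSplit (↥(maximalRealSubfield L)) L (IsCMField.complexConj L) 2).Adelic → ℂ) (a : ℝ≥0) (κ : I → ℝ≥0)
      (T : I → HX (↥(maximalRealSubfield L)) L (IsCMField.complexConj L) 2 (n + 3) μ →L[ℂ] HX (↥(maximalRealSubfield L)) L (IsCMField.complexConj L) 2 (n + 3) μ) (U : Set ℂ) (vX : ℂ → HX (↥(maximalRealSubfield L)) L (IsCMField.complexConj L) 2 (n + 3) μ) (cc : ℂ → ℂ),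
      -- (R1) the `GL₂`-test functions `η_i` behind the `h_i` (smooth, non-negative, symmetric, bi-`K`-invariant)
      (∀ i, IsTestFunctionGL 2 L (η i) ∧ (∀ g, 0 ≤ η i g) ∧ (∀ g, η i g⁻¹ = η i g) ∧
        ∀ k₁ k₂ : (quasiSplit (↥(maximalRealSubfield L)) L (IsCMField.complexConj L) 2).Adelic, adelicVal (↥(maximalRealSubfield L)) L (IsCMField.complexConj L) 2 ((StdForm.antidiagonal 2).over L) k₁ ∈ standardMaximalCompactGL 2 L → adelicVal (↥(maximalRealSubfield L)) L (IsCMField.complexConj L) 2 ((StdForm.antidiagonal 2).over L) k₂ ∈ standardMaximalCompactGL 2 L →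
            ∀ x, η i (adelicVal (↥(maximalRealSubfield L)) L (IsCMField.complexConj L) 2 ((StdForm.antidiagonal 2).over L) (k₁ * x * k₂)) = η i (adelicVal (↥(maximalRealSubfield L)) L (IsCMField.complexConj L) 2 ((StdForm.antidiagonal 2).over L) x)) ∧
      -- the test functions `h_i = S_{η_i} η_i := orbitalSmoothing ν_G η_i η_i`, their regularity, and the cover of the ball by their height transforms `ĥ_i`
      (∀ i, h i = fun y : (quasiSplit (↥(maximalRealSubfield L)) L (IsCMField.complexConj L) 2).Adelic => orbitalSmoothing νG (fun x : (quasiSplit (↥(maximalRealSubfield L)) L (IsCMField.complexConj L) 2).Adelic => ((η i (adelicVal (↥(maximalRealSubfield L)) L (IsCMField.complexConj L) 2 ((StdForm.antidiagonal 2).over L) x) : ℝ) : ℂ)) (fun x : (quasiSplit (↥(maximalRealSubfield L)) L (IsCMField.complexConj L) 2).Adelic => ((η i (adelicVal (↥(maximalRealSubfield L)) L (IsCMField.complexConj L) 2 ((StdForm.antidiagonal 2).over L) x) : ℝ) : ℂ)) y) ∧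
      (∀ i, Continuous (h i) ∧ HasCompactSupport (h i) ∧
        (∀ k₀ : (quasiSplit (↥(maximalRealSubfield L)) L (IsCMField.complexConj L) 2).Adelic, adelicVal (↥(maximalRealSubfield L)) L (IsCMField.complexConj L) 2 ((StdForm.antidiagonal 2).over L) k₀ ∈ standardMaximalCompactGL 2 L → ∀ x, h i (k₀ * x) = h i x) ∧
        (∀ g, h i g⁻¹ = h i g) ∧ (∀ g, conj (h i g) = h i g) ∧ (∀ g, 0 ≤ (h i g).re)) ∧
      (∀ z ∈ Metric.ball (0 : ℂ) (n + 2), ∃ i, (∫ x, h i x * (((borelHeight x : ℝ≥0) : ℝ) : ℂ) ^ z ∂νG) ≠ 0) ∧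
      -- (R3) the levels: `0 < a`, `1 ≤ κ_i`, and the height distortion `H_Z(z) ≤ κ_i·H_Z(z·y)` on `tsupport h_i`
      0 < a ∧ (∀ i, 1 ≤ κ i) ∧
      (∀ i, ∀ z : borelQuotient (↥(maximalRealSubfield L)) L (IsCMField.complexConj L) 2, ∀ y ∈ tsupport (h i), borelQuotHeight (↥(maximalRealSubfield L)) L (IsCMField.complexConj L) 2 z ≤ κ i * borelQuotHeight (↥(maximalRealSubfield L)) L (IsCMField.complexConj L) 2 (rightShift (↥(maximalRealSubfield L)) L (IsCMField.complexConj L) 2 y z)) ∧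
      -- (R2) the convolution formula of the `T_i = T_X(h_i)`
      (∀ i, ∀ u : HX (↥(maximalRealSubfield L)) L (IsCMField.complexConj L) 2 (n + 3) μ, (T i u : (quasiSplit (↥(maximalRealSubfield L)) L (IsCMField.complexConj L) 2).automorphicQuotient → ℂ) =ᵐ[μ.withDensity fun x => (((supHeight (↥(maximalRealSubfield L)) L (IsCMField.complexConj L) 2 x)⁻¹ ^ (2 * (n + 3)) : ℝ≥0) : ℝ≥0∞)]
          fun ξ => ∫ y, h i y * (u : (quasiSplit (↥(maximalRealSubfield L)) L (IsCMField.complexConj L) 2).automorphicQuotient → ℂ) (y⁻¹ • ξ) ∂νG) ∧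
      -- the holomorphy set `U` (open, dense in the ball, co-discrete)
      IsOpen U ∧ U ⊆ Metric.ball (0 : ℂ) (n + 2) ∧ Metric.ball (0 : ℂ) (n + 2) ⊆ closure U ∧ (∀ z₀ ∈ Metric.ball (0 : ℂ) (n + 2), ∀ᶠ s in 𝓝[≠] z₀, s ∈ U) ∧
      -- the vector solution `v_X` and the coefficient `cc`: holomorphy on `U`, meromorphy, the Godement agreement, the `T`-eigen-equations
      DifferentiableOn ℂ vX U ∧ MeromorphicOn vX (Metric.ball (0 : ℂ) (n + 2)) ∧ DifferentiableOn ℂ cc U ∧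
      (∀ z ∈ U, 1 < z.re → ((vX z : HX (↥(maximalRealSubfield L)) L (IsCMField.complexConj L) 2 (n + 3) μ) : (quasiSplit (↥(maximalRealSubfield L)) L (IsCMField.complexConj L) 2).automorphicQuotient → ℂ) =ᵐ[(μ.withDensity fun x => (((supHeight (↥(maximalRealSubfield L)) L (IsCMField.complexConj L) 2 x)⁻¹ ^ (2 * (n + 3)) : ℝ≥0) : ℝ≥0∞))] (quasiSplit (↥(maximalRealSubfield L)) L (IsCMField.complexConj L) 2).quotFun (eisensteinSeriesU (flatSectionU (fun _ : (quasiSplit (↥(maximalRealSubfield L)) L (IsCMField.complexConj L) 2).Adelic => φ₀) z))) ∧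
      (∀ z ∈ U, ∀ i, T i (vX z) = (∫ x, h i x * (((borelHeight x : ℝ≥0) : ℝ) : ℂ) ^ z ∂νG) • vX z) ∧
      -- the `α`-system at level `a`: `cnst_N(ι v_X(z)) = φ₀·α₁(z) + cc(z)·α₂(z)` on `U`
      (∃ (hb : IotaBound (↥(maximalRealSubfield L)) L (IsCMField.complexConj L) 2 (n + 3) a μ μZ) (α₁ α₂ : ℂ → HN (↥(maximalRealSubfield L)) L (IsCMField.complexConj L) 2 (n + 3) a μZ),
        (∀ z ∈ Metric.ball (0 : ℂ) (n + 2), (α₁ z : borelQuotient (↥(maximalRealSubfield L)) L (IsCMField.complexConj L) 2 → ℂ) =ᵐ[weightedTruncMeasure (↥(maximalRealSubfield L)) L (IsCMField.complexConj L) 2 (n + 3) a μZ] fun x => (((borelQuotHeight (↥(maximalRealSubfield L)) L (IsCMField.complexConj L) 2 x : ℝ≥0) : ℝ) : ℂ) ^ z) ∧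
        (∀ z ∈ Metric.ball (0 : ℂ) (n + 2), (α₂ z : borelQuotient (↥(maximalRealSubfield L)) L (IsCMField.complexConj L) 2 → ℂ) =ᵐ[weightedTruncMeasure (↥(maximalRealSubfield L)) L (IsCMField.complexConj L) 2 (n + 3) a μZ] fun x => (((borelQuotHeight (↥(maximalRealSubfield L)) L (IsCMField.complexConj L) 2 x : ℝ≥0) : ℝ) : ℂ) ^ (1 - z)) ∧
        (∀ z ∈ Metric.ball (0 : ℂ) (n + 2), α₂ z ≠ 0) ∧
        (∀ z ∈ U, cnstN (↥(maximalRealSubfield L)) L (IsCMField.complexConj L) 2 (n + 3) a μZ (iota hb (vX z)) = φ₀ • α₁ z + cc z • α₂ z) ∧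
        -- UNIQUENESS of the `𝔛_z`-system on `U` [BernsteinLapid2019, §4 Claim 3, §5]
        ∀ z ∈ U, ∀ (ψ : HX (↥(maximalRealSubfield L)) L (IsCMField.complexConj L) 2 (n + 3) μ) (b : ℂ), (∀ i, T i ψ = (∫ x, h i x * (((borelHeight x : ℝ≥0) : ℝ) : ℂ) ^ z ∂νG) • ψ) →
          cnstN (↥(maximalRealSubfield L)) L (IsCMField.complexConj L) 2 (n + 3) a μZ (iota hb ψ) = φ₀ • α₁ z + b • α₂ z → ψ = vX z ∧ b = cc z) ∧
      -- (R4) per `g`: the scalar piece `Ec_g` — meromorphic on the ball, `= E(φ₀H^z)(g)` on the Godement part, order `≥ 0` on `U`, and its germs IN INTEGRAL FORM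
      ∀ g : (quasiSplit (↥(maximalRealSubfield L)) L (IsCMField.complexConj L) 2).Adelic, ∃ Ec : ℂ → ℂ, MeromorphicOn Ec (Metric.ball (0 : ℂ) (n + 2)) ∧ (∀ z ∈ Metric.ball (0 : ℂ) (n + 2), 1 < z.re → Ec z = eisensteinSeriesU (flatSectionU (fun _ : (quasiSplit (↥(maximalRealSubfield L)) L (IsCMField.complexConj L) 2).Adelic => φ₀) z) g) ∧ (∀ z ∈ U, 0 ≤ meromorphicOrderAt Ec z) ∧
        ∀ j, ∀ z ∈ U, (∫ x, h j x * (((borelHeight x : ℝ≥0) : ℝ) : ℂ) ^ z ∂νG) ≠ 0 →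
          Ec =ᶠ[𝓝[≠] z] fun s => (∫ x, h j x * (((borelHeight x : ℝ≥0) : ℝ) : ℂ) ^ s ∂νG)⁻¹ * ∫ y, h j y * ((vX s : HX (↥(maximalRealSubfield L)) L (IsCMField.complexConj L) 2 (n + 3) μ) : (quasiSplit (↥(maximalRealSubfield L)) L (IsCMField.complexConj L) 2).automorphicQuotient → ℂ) ((quasiSplit (↥(maximalRealSubfield L)) L (IsCMField.complexConj L) 2).toAutomorphicQuotient (g * y)⁻¹) ∂νG := by
  classical
  -- involution facts and a non-zero trace-zero element of `L`
  have hc : IsCMField.complexConj L * IsCMField.complexConj L = 1 :=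
    AlgEquiv.ext fun x => by rw [AlgEquiv.mul_apply, AlgEquiv.one_apply, IsCMField.complexConj_apply_apply]
  have hc1 : IsCMField.complexConj L ≠ 1 := IsCMField.complexConj_ne_one L
  obtain ⟨δ, hcδ, hδ⟩ : ∃ δ : L, IsCMField.complexConj L δ = -δ ∧ δ ≠ 0 := by
    obtain ⟨e, he⟩ : ∃ e : L, IsCMField.complexConj L e ≠ e := by
      by_contra h
      exact hc1 (AlgEquiv.ext fun x => not_ne_iff.mp (not_exists.mp h x))
    exact ⟨e - IsCMField.complexConj L e, by rw [map_sub, IsCMField.complexConj_apply_apply, neg_sub], sub_ne_zero.2 (Ne.symm he)⟩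
  have h𝓕top : ν 𝓕 ≠ ∞ := ((measure_mono subset_closure).trans_lt h𝓕c.measure_lt_top).ne
  haveI : νG.IsMulRightInvariant := by rw [← Measure.inv_eq_self νG]; infer_instance
  have hright := measurePreserving_rightShift_of_unfolding νG hβ hμZ
  have hk : (n : ℝ) + 3 ≤ ((n + 3 : ℕ) : ℝ) := by push_cast; exact le_rfl
  -- the structural data of the ball (★ `exists_convData_cm_two`)
  obtain ⟨a, ha, I, hIf, i₀, η, κ, T, hη, hconv, h1, hcov, hĥ₀, hκ, hcmp, hι, hne, hT, hpack⟩ := exists_convData_cm_two L μ νG hβ hμZ n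
  choose hpos hinj hcl using hι
  choose hs hδι using hpack
  have hb : IotaBound (↥(maximalRealSubfield L)) L (IsCMField.complexConj L) 2 (n + 3) a μ μZ := iotaBound_cm L μ νG hβ hμZ ha (n + 3)
  have hfin : μZ {z | a < borelQuotHeight (↥(maximalRealSubfield L)) L (IsCMField.complexConj L) 2 z} ≠ ∞ := measure_setOf_lt_ne_top_cm L μ νG hβ hμZ ha
  haveI : IsFiniteMeasure (weightedTruncMeasure (↥(maximalRealSubfield L)) L (IsCMField.complexConj L) 2 (n + 3) a μZ) := isFiniteMeasure_weightedTruncMeasure_cm L μ νG hβ hμZ ha (n + 3)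
  have hfin₀ : ∀ i, IsFiniteMeasure (weightedTruncMeasure (↥(maximalRealSubfield L)) L (IsCMField.complexConj L) 2 (n + 3) (κ i * a) μZ) := fun i =>
    isFiniteMeasure_weightedTruncMeasure_cm L μ νG hβ hμZ (hpos i) (n + 3)
  -- K2's letter at the system levels `(a, κ_i a)`: ★ `hK1_cm_two_of` with `hcuspN` := ★ K2-defs1 (ii) ∘ ★ `map_conj_toAdelic_eq_self_two` (closer₂ ED. 3), `m = 0`
  letI : MeasurableSpace (AdeleRing (𝓞 L) L) := borel _
  haveI : BorelSpace (AdeleRing (𝓞 L) L) := ⟨rfl⟩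
  have hK1i : ∀ i, ∃ m C : ℝ, 0 ≤ m ∧ 0 ≤ C ∧ ∀ f : HNcusp (↥(maximalRealSubfield L)) L (IsCMField.complexConj L) 2 (n + 3) a μZ, ∀ᵐ z ∂(weightedTruncMeasure (↥(maximalRealSubfield L)) L (IsCMField.complexConj L) 2 (n + 3) (κ i * a) μZ),
      ‖rightConvFun (↥(maximalRealSubfield L)) L (IsCMField.complexConj L) 2 νG ((fun (i : I) (y : (quasiSplit (↥(maximalRealSubfield L)) L (IsCMField.complexConj L) 2).Adelic) => orbitalSmoothing νG (fun x : (quasiSplit (↥(maximalRealSubfield L)) L (IsCMField.complexConj L) 2).Adelic => ((η i (adelicVal (↥(maximalRealSubfield L)) L (IsCMField.complexConj L) 2 ((StdForm.antidiagonal 2).over L) x) : ℝ) : ℂ)) (fun x : (quasiSplit (↥(maximalRealSubfield L)) L (IsCMField.complexConj L) 2).Adelic => ((η i (adelicVal (↥(maximalRealSubfield L)) L (IsCMField.complexConj L) 2 ((StdForm.antidiagonal 2).over L) x) : ℝ) : ℂ)) y) i) ((f : HN (↥(maximalRealSubfield L)) L (IsCMField.complexConj L) 2 (n + 3) a μZ)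 : borelQuotient (↥(maximalRealSubfield L)) L (IsCMField.complexConj L) 2 → ℂ) z‖ ≤ C * ‖f‖ * ((borelQuotHeight (↥(maximalRealSubfield L)) L (IsCMField.complexConj L) 2 z : ℝ)) ^ (-m) := fun i => by
    obtain ⟨C₀, hC₀, hh⟩ := K2E1TruncatedCuspDecayHK1CMTwo.hK1_cm_two_of L μZ νG hβ hμZ (hη i).1 (n + 3) a (κ i * a) (hpos i)
      (fun νN _ _ _ 𝓕N h𝓕 h0 htop f => K2E1TruncatedCuspConstantTermAEU2.ae_borelConstantTerm_indicator_comp_eq_zero_of_mem_HNcusp νG νN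
        (fun _ hb₀ => map_conj_toAdelic_eq_self_two hc hc1 νN hb₀) h𝓕 h0 htop hβ hμZ (n + 3) a f)
      (lt_of_lt_of_le zero_lt_one (hκ i).1) le_rfl (hcmp i) (m := 0) le_rfl
    exact ⟨0, C₀, le_rfl, hC₀, hh⟩
  choose m C hm hC hK1' using hK1i
  -- the constant-term vectors (★ ℓ7)
  obtain ⟨α₁, α₂, hα₁, hα₂, -, hα₂ne⟩ := exists_constantTermVectors (F := ↥(maximalRealSubfield L)) (E := L) (c := IsCMField.complexConj L) (N := 2)
    (k := n + 3) (μZ := μZ) n hk ha hfin hne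
  -- the identification `zFun (H^w) = HZ^w`
  have hzF : ∀ w : ℂ, zFun (↥(maximalRealSubfield L)) L (IsCMField.complexConj L) 2 (fun g : (quasiSplit (↥(maximalRealSubfield L)) L (IsCMField.complexConj L) 2).Adelic => (((borelHeight g : ℝ)) : ℂ) ^ w) = fun x => (((borelQuotHeight (↥(maximalRealSubfield L)) L (IsCMField.complexConj L) 2 x : ℝ≥0) : ℝ) : ℂ) ^ w := by
    intro w
    funext x
    obtain ⟨g₁, rfl⟩ : ∃ g₁, toBorelQuotient (↥(maximalRealSubfield L)) L (IsCMField.complexConj L) 2 g₁ = x := Quotient.exists_rep x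
    refine zFun_toBorelQuotient (↥(maximalRealSubfield L)) L (IsCMField.complexConj L) 2 (fun γ hγ g' => ?_) g₁
    obtain ⟨γ₀, hγ₀, hγ₀B⟩ := exists_eq_toAdelic_of_mem_ratBorelSubgroup (↥(maximalRealSubfield L)) L (IsCMField.complexConj L) 2 hγ
    simp only [← hγ₀, borelHeight_rational_borel_mul γ₀ hγ₀B]
  -- the Eisenstein data on the Godement part of the ball ((b1), S1, S2)
  have hzk : ∀ z ∈ Metric.ball (0 : ℂ) (n + 2), z.re ≤ ((n + 3 : ℕ) : ℝ) := fun z hz => by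
    have h1 : z.re ≤ ‖z‖ := Complex.re_le_norm z
    have h2 : ‖z‖ < n + 2 := mem_ball_zero_iff.1 hz
    push_cast
    linarith
  have hE : ∀ z : ℂ, z ∈ Metric.ball (0 : ℂ) (n + 2) ∧ 1 < z.re → MemLp ((quasiSplit (↥(maximalRealSubfield L)) L (IsCMField.complexConj L) 2).quotFun (eisensteinSeriesU (flatSectionU (fun _ : (quasiSplit (↥(maximalRealSubfield L)) L (IsCMField.complexConj L) 2).Adelic => φ₀) z))) 2 (μ.withDensity fun x => (((supHeight (↥(maximalRealSubfield L)) L (IsCMField.complexConj L) 2 x)⁻¹ ^ (2 * (n + 3)) : ℝ≥0) : ℝ≥0∞)) := fun z hz =>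
    eisensteinSeriesU_flatSectionU_memHX_cm_two L hcδ hδ ν h𝓕N h𝓕c μ φ₀ (n + 3) hz.2 (hzk z hz.1)
  have hαF₁ : ∀ z ∈ Metric.ball (0 : ℂ) (n + 2), MemLp (zFun (↥(maximalRealSubfield L)) L (IsCMField.complexConj L) 2 (fun g : (quasiSplit (↥(maximalRealSubfield L)) L (IsCMField.complexConj L) 2).Adelic => (((borelHeight g : ℝ)) : ℂ) ^ z)) 2
      (weightedTruncMeasure (↥(maximalRealSubfield L)) L (IsCMField.complexConj L) 2 (n + 3) a μZ) := fun z hz => by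
    rw [hzF]; exact (Lp.memLp (α₁ z)).ae_eq (hα₁ z hz)
  have hαF₂ : ∀ z ∈ Metric.ball (0 : ℂ) (n + 2), MemLp (zFun (↥(maximalRealSubfield L)) L (IsCMField.complexConj L) 2 (fun g : (quasiSplit (↥(maximalRealSubfield L)) L (IsCMField.complexConj L) 2).Adelic => (((borelHeight g : ℝ)) : ℂ) ^ (1 - z))) 2
      (weightedTruncMeasure (↥(maximalRealSubfield L)) L (IsCMField.complexConj L) 2 (n + 3) a μZ) := fun z hz => by
    rw [hzF]; exact (Lp.memLp (α₂ z)).ae_eq (hα₂ z hz)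
  have htoHN₁ : ∀ z (hz : z ∈ Metric.ball (0 : ℂ) (n + 2)),
      toHN (↥(maximalRealSubfield L)) L (IsCMField.complexConj L) 2 (n + 3) a μZ (fun g : (quasiSplit (↥(maximalRealSubfield L)) L (IsCMField.complexConj L) 2).Adelic => (((borelHeight g : ℝ)) : ℂ) ^ z) (hαF₁ z hz) = α₁ z := fun z hz =>
    Lp.ext ((coeFn_toHN (↥(maximalRealSubfield L)) L (IsCMField.complexConj L) 2 (n + 3) a μZ _ (hαF₁ z hz)).trans (by rw [hzF]; exact (hα₁ z hz).symm))
  have htoHN₂ : ∀ z (hz : z ∈ Metric.ball (0 : ℂ) (n + 2)),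
      toHN (↥(maximalRealSubfield L)) L (IsCMField.complexConj L) 2 (n + 3) a μZ (fun g : (quasiSplit (↥(maximalRealSubfield L)) L (IsCMField.complexConj L) 2).Adelic => (((borelHeight g : ℝ)) : ℂ) ^ (1 - z)) (hαF₂ z hz) = α₂ z := fun z hz =>
    Lp.ext ((coeFn_toHN (↥(maximalRealSubfield L)) L (IsCMField.complexConj L) 2 (n + 3) a μZ _ (hαF₂ z hz)).trans (by rw [hzF]; exact (hα₂ z hz).symm))
  -- the disintegration letter of S2, paid by ★ `integral_zFun_borelConstantTerm_eq_of_unfolding` (`hconj` ★ at `N = 2`)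
  have hdis' : ∀ Φ : (quasiSplit (↥(maximalRealSubfield L)) L (IsCMField.complexConj L) 2).Adelic → ℂ, Measurable Φ → (∀ b ∈ ratBorelSubgroup (↥(maximalRealSubfield L)) L (IsCMField.complexConj L) 2, ∀ g, Φ (b * g) = Φ g) →
      Integrable (zFun (↥(maximalRealSubfield L)) L (IsCMField.complexConj L) 2 Φ) (weightedTruncMeasure (↥(maximalRealSubfield L)) L (IsCMField.complexConj L) 2 (n + 3) a μZ) →
      Integrable (zFun (↥(maximalRealSubfield L)) L (IsCMField.complexConj L) 2 (borelConstantTerm ν 𝓕 Φ)) (weightedTruncMeasure (↥(maximalRealSubfield L)) L (IsCMField.complexConj L) 2 (n + 3) a μZ) →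
        ∫ x, zFun (↥(maximalRealSubfield L)) L (IsCMField.complexConj L) 2 (borelConstantTerm ν 𝓕 Φ) x ∂(weightedTruncMeasure (↥(maximalRealSubfield L)) L (IsCMField.complexConj L) 2 (n + 3) a μZ) =
          ∫ x, zFun (↥(maximalRealSubfield L)) L (IsCMField.complexConj L) 2 Φ x ∂(weightedTruncMeasure (↥(maximalRealSubfield L)) L (IsCMField.complexConj L) 2 (n + 3) a μZ) := fun Φ hΦm hΦB hint hint' =>
    integral_zFun_borelConstantTerm_eq_of_unfolding νG ν (fun _ hb₀ => map_conj_toAdelic_eq_self_two hc hc1 ν hb₀) h𝓕N h𝓕₀ h𝓕top hβ hμZ (n + 3) a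
      hΦm hΦB hint hint'
  have hS2 : ∀ z (hz : z ∈ Metric.ball (0 : ℂ) (n + 2) ∧ 1 < z.re), ∃ b : ℂ,
      cnstN (↥(maximalRealSubfield L)) L (IsCMField.complexConj L) 2 (n + 3) a μZ (iota hb (toHX (↥(maximalRealSubfield L)) L (IsCMField.complexConj L) 2 (n + 3) μ (eisensteinSeriesU (flatSectionU (fun _ : (quasiSplit (↥(maximalRealSubfield L)) L (IsCMField.complexConj L) 2).Adelic => φ₀) z)) (hE z hz))) = φ₀ • α₁ z + b • α₂ z := fun z hz => by
    obtain ⟨b, hb'⟩ := exists_cnstN_iota_toHX_eisensteinSeriesU_eq_cm_two L ν h𝓕N h𝓕c hb hdis' φ₀ hz.2 (hE z hz) (hαF₁ z hz.1) (hαF₂ z hz.1)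
    rw [htoHN₁ z hz.1, htoHN₂ z hz.1] at hb'
    exact ⟨b, hb'⟩
  choose bX' hbX' using hS2
  -- the solution pair `(eX, bX)` (zero off the Godement part of the ball)
  obtain ⟨eX, heX⟩ : ∃ eX : ℂ → HX (↥(maximalRealSubfield L)) L (IsCMField.complexConj L) 2 (n + 3) μ, eX = fun z =>
      if hz : z ∈ Metric.ball (0 : ℂ) (n + 2) ∧ 1 < z.re then toHX (↥(maximalRealSubfield L)) L (IsCMField.complexConj L) 2 (n + 3) μ (eisensteinSeriesU (flatSectionU (fun _ : (quasiSplit (↥(maximalRealSubfield L)) L (IsCMField.complexConj L) 2).Adelic => φ₀) z)) (hE z hz) else 0 := ⟨_, rfl⟩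
  obtain ⟨bX, hbX⟩ : ∃ bX : ℂ → ℂ, bX = fun z => if hz : z ∈ Metric.ball (0 : ℂ) (n + 2) ∧ 1 < z.re then bX' z hz else 0 := ⟨_, rfl⟩
  have heXz : ∀ z (hz : z ∈ Metric.ball (0 : ℂ) (n + 2) ∧ 1 < z.re), eX z = toHX (↥(maximalRealSubfield L)) L (IsCMField.complexConj L) 2 (n + 3) μ (eisensteinSeriesU (flatSectionU (fun _ : (quasiSplit (↥(maximalRealSubfield L)) L (IsCMField.complexConj L) 2).Adelic => φ₀) z)) (hE z hz) := fun z hz => by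
    rw [heX]; exact dif_pos hz
  have hsolT : ∀ z ∈ Metric.ball (0 : ℂ) (n + 2), 1 < z.re → ∀ i,
      T i (eX z) = (∫ x, (fun (i : I) (y : (quasiSplit (↥(maximalRealSubfield L)) L (IsCMField.complexConj L) 2).Adelic) => orbitalSmoothing νG (fun x : (quasiSplit (↥(maximalRealSubfield L)) L (IsCMField.complexConj L) 2).Adelic => ((η i (adelicVal (↥(maximalRealSubfield L)) L (IsCMField.complexConj L) 2 ((StdForm.antidiagonal 2).over L) x) : ℝ) : ℂ)) (fun x : (quasiSplit (↥(maximalRealSubfield L)) L (IsCMField.complexConj L) 2).Adelic => ((η i (adelicVal (↥(maximalRealSubfield L)) L (IsCMField.complexConj L) 2 ((StdForm.antidiagonal 2).over L) x) : ℝ) : ℂ)) y) i x * (((borelHeight x : ℝ≥0) : ℝ) : ℂ) ^ z ∂νG) • eX z := fun z hz hz1 i => by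
    rw [heXz z ⟨hz, hz1⟩]
    exact shiftOperatorX_toHX_eisensteinSeriesU_eq_smul_cm_two L μ νG (hconv i).2.2.1 (hconv i).1 (hconv i).2.1 φ₀ hz1 (hE z ⟨hz, hz1⟩) (T i) (hT i)
  have hsolC : ∀ z ∈ Metric.ball (0 : ℂ) (n + 2), 1 < z.re →
      cnstN (↥(maximalRealSubfield L)) L (IsCMField.complexConj L) 2 (n + 3) a μZ (iota hb (eX z)) = φ₀ • α₁ z + bX z • α₂ z := fun z hz hz1 => by
    rw [heXz z ⟨hz, hz1⟩, hbX]
    dsimp only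
    rw [dif_pos ⟨hz, hz1⟩]
    exact hbX' z ⟨hz, hz1⟩
  have hsolQ : ∀ z ∈ Metric.ball (0 : ℂ) (n + 2), 1 < z.re → (0 : HX (↥(maximalRealSubfield L)) L (IsCMField.complexConj L) 2 (n + 3) μ →L[ℂ] HX (↥(maximalRealSubfield L)) L (IsCMField.complexConj L) 2 (n + 3) μ) (eX z) = 0 := fun _ _ _ => rfl
  -- the essential bound of `δ(α₂ z)` (★ payer) and the uniqueness letter (★ P6′ one-call)
  have hδα₂ : ∀ z ∈ Metric.ball (0 : ℂ) (n + 2), 1 < z.re → ∃ M : ℝ, ∀ᵐ x ∂(weightedTruncMeasure (↥(maximalRealSubfield L)) L (IsCMField.complexConj L) 2 (n + 3) (κ i₀ * a) μZ),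
      ‖(deltaShift (hs i₀) (α₂ z) : borelQuotient (↥(maximalRealSubfield L)) L (IsCMField.complexConj L) 2 → ℂ) x‖ ≤ M := fun z hz hz1 =>
    exists_ae_norm_deltaShift_le_of_ae_eq_cpow hright (isClosed_tsupport _).measurableSet (lt_of_lt_of_le zero_lt_one (hκ i₀).1) le_rfl (hcmp i₀)
      (fun y hy => image_eq_zero_of_notMem_tsupport hy) ((hconv i₀).1.integrable_of_hasCompactSupport (hconv i₀).2.1) (hs i₀) ha (hα₂ z hz)
      (by rw [Complex.sub_re, Complex.one_re]; linarith)
  have hunq := hunq_cm_two L μ νG hβ hμZ (n + 3) n i₀ (h := (fun (i : I) (y : (quasiSplit (↥(maximalRealSubfield L)) L (IsCMField.complexConj L) 2).Adelic) => orbitalSmoothing νG (fun x : (quasiSplit (↥(maximalRealSubfield L)) L (IsCMField.complexConj L) 2).Adelic => ((η i (adelicVal (↥(maximalRealSubfield L)) L (IsCMField.complexConj L) 2 ((StdForm.antidiagonal 2).over L) x) : ℝ) : ℂ)) (fun x : (quasiSplit (↥(maximalRealSubfield L)) L (IsCMField.complexConj L) 2).Adelic => ((η i (adelicVal (↥(maximalRealSubfield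 L)) L (IsCMField.complexConj L) 2 ((StdForm.antidiagonal 2).over L) x) : ℝ) : ℂ)) y)) (fun i => (hconv i).1) (fun i => (hconv i).2.1) (hconv i₀).2.2.2.1
    (hconv i₀).2.2.2.2.1 (hconv i₀).2.2.2.2.2 h1 (hpos i₀) (hκ i₀).2 hfin hb (hs i₀) T (hT i₀) (hδι i₀ (hκ i₀).2) (hC i₀) (hm i₀) (hK1' i₀) α₁ α₂ hδα₂
    (0 : HX (↥(maximalRealSubfield L)) L (IsCMField.complexConj L) 2 (n + 3) μ →L[ℂ] HX (↥(maximalRealSubfield L)) L (IsCMField.complexConj L) 2 (n + 3) μ) φ₀ eX bX hsolT hsolC hsolQ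
  -- ── the by-products of the `𝔛`-system on the ball (★ `exists_xSystem_byproducts`; letters as the closer's `…_ball_of_letters` call minus `i₀`, the cover witness, `g Λ hΛ'`) ──
  obtain ⟨U, vX, cc, hUo, hUD, hDcl, hUcd, hvXd, hvXm, hccd, heqs, huniq, hagree, hrepr⟩ :=
    exists_xSystem_byproducts n (n + 3) hk νG ha (a₀ := fun i => κ i * a) (fun i => (hκ i).2) hfin (hfin₀ := hfin₀) hb
      (fun i => iotaBound_cm L μ νG hβ hμZ (hpos i) (n + 3)) hcl hinj (fun (i : I) (y : (quasiSplit (↥(maximalRealSubfield L)) L (IsCMField.complexConj L) 2).Adelic) => orbitalSmoothing νG (fun x : (quasiSplit (↥(maximalRealSubfield L)) L (IsCMField.complexConj L) 2).Adelic => ((η i (adelicVal (↥(maximalRealSubfield L)) L (IsCMField.complexConj L) 2 ((StdForm.antidiagonal 2).over L) x) : ℝ) : ℂ)) (fun x : (quasiSplit (↥(maximalRealSubfield L)) L (IsCMField.complexConj L) 2).Adelic => ((η i (adelicVal (↥(maximalRealSubfield L)) L (IsCMField.complexConj L) 2 ((StdForm.antidiagonal 2).over L) x) : ℝ) : ℂ))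 y) (fun i => (hconv i).1) (fun i => (hconv i).2.1) hcov
      hs hm hC hK1' T (fun i => hδι i (hκ i).2) hα₁ hα₂ hα₂ne
      (0 : HX (↥(maximalRealSubfield L)) L (IsCMField.complexConj L) 2 (n + 3) μ →L[ℂ] HX (↥(maximalRealSubfield L)) L (IsCMField.complexConj L) 2 (n + 3) μ) φ₀ eX bX hsolT hsolC hsolQ hunq
  -- realness of the `h_i`
  have hre : ∀ i x, (((((fun (i : I) (y : (quasiSplit (↥(maximalRealSubfield L)) L (IsCMField.complexConj L) 2).Adelic) => orbitalSmoothing νG (fun x : (quasiSplit (↥(maximalRealSubfield L)) L (IsCMField.complexConj L) 2).Adelic => ((η i (adelicVal (↥(maximalRealSubfield L)) L (IsCMField.complexConj L) 2 ((StdForm.antidiagonal 2).over L) x) : ℝ) : ℂ)) (fun x : (quasiSplit (↥(maximalRealSubfield L)) L (IsCMField.complexConj L) 2).Adelic => ((η i (adelicVal (↥(maximalRealSubfield L)) L (IsCMField.complexConj L) 2 ((StdForm.antidiagonal 2).over L) x) : ℝ) : ℂ)) y) i x).re : ℝ)) : ℂ) = (fun (i : I) (y : (quasiSplit (↥(maximalRealSubfield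 L)) L (IsCMField.complexConj L) 2).Adelic) => orbitalSmoothing νG (fun x : (quasiSplit (↥(maximalRealSubfield L)) L (IsCMField.complexConj L) 2).Adelic => ((η i (adelicVal (↥(maximalRealSubfield L)) L (IsCMField.complexConj L) 2 ((StdForm.antidiagonal 2).over L) x) : ℝ) : ℂ)) (fun x : (quasiSplit (↥(maximalRealSubfield L)) L (IsCMField.complexConj L) 2).Adelic => ((η i (adelicVal (↥(maximalRealSubfield L)) L (IsCMField.complexConj L) 2 ((StdForm.antidiagonal 2).over L) x) : ℝ) : ℂ)) y) i x := fun i x => Complex.conj_eq_iff_re.1 ((hconv i).2.2.2.2.1 x)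
  refine ⟨I, hIf, η, (fun (i : I) (y : (quasiSplit (↥(maximalRealSubfield L)) L (IsCMField.complexConj L) 2).Adelic) => orbitalSmoothing νG (fun x : (quasiSplit (↥(maximalRealSubfield L)) L (IsCMField.complexConj L) 2).Adelic => ((η i (adelicVal (↥(maximalRealSubfield L)) L (IsCMField.complexConj L) 2 ((StdForm.antidiagonal 2).over L) x) : ℝ) : ℂ)) (fun x : (quasiSplit (↥(maximalRealSubfield L)) L (IsCMField.complexConj L) 2).Adelic => ((η i (adelicVal (↥(maximalRealSubfield L)) L (IsCMField.complexConj L) 2 ((StdForm.antidiagonal 2).over L) x) : ℝ) : ℂ)) y), a, κ, T, U, vX, cc, hη, fun i => rfl, hconv, hcov, ha, fun i => (hκ i).1, hcmp, hT, hUo, hUD, hDcl, hUcd, hvXd, hvXm, hccd,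
    fun z hz hz1 => ?_, fun z hz i => (heqs z hz).1 i, ⟨hb, α₁, α₂, hα₁, hα₂, hα₂ne, fun z hz => (heqs z hz).2.1, fun z hz ψ b hψT hψC => huniq z hz ψ b hψT hψC rfl⟩, fun g => ?_⟩
  · -- Godement agreement, a.e. form
    rw [(hagree z hz hz1).1, heXz z ⟨hUD hz, hz1⟩]
    exact MemLp.coeFn_toLp _
  · -- the evaluation functionals for EVERY `i` (★ P3-D `exists_evalCLM` on the real functions `Re h_i = h_i`) and the scalar piece (★ `hrepr`)
    have hΛex : ∀ i, ∃ Λ : HX (↥(maximalRealSubfield L)) L (IsCMField.complexConj L) 2 (n + 3) μ →L[ℂ] ℂ, ∀ (u : (quasiSplit (↥(maximalRealSubfield L)) L (IsCMField.complexConj L) 2).Adelic → ℂ) (huG : ∀ γ ∈ (quasiSplit (↥(maximalRealSubfield L)) L (IsCMField.complexConj L) 2).quotientSubgroup, ∀ y, u (γ * y) = u y) (hu : MemLp ((quasiSplit (↥(maximalRealSubfield L)) L (IsCMField.complexConj L) 2).quotFun u) 2 (μ.withDensity fun x => (((supHeight (↥(maximalRealSubfield L)) L (IsCMField.complexConj L)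 2 x)⁻¹ ^ (2 * (n + 3)) : ℝ≥0) : ℝ≥0∞))),
        Integrable (fun y => (((((fun (i : I) (y : (quasiSplit (↥(maximalRealSubfield L)) L (IsCMField.complexConj L) 2).Adelic) => orbitalSmoothing νG (fun x : (quasiSplit (↥(maximalRealSubfield L)) L (IsCMField.complexConj L) 2).Adelic => ((η i (adelicVal (↥(maximalRealSubfield L)) L (IsCMField.complexConj L) 2 ((StdForm.antidiagonal 2).over L) x) : ℝ) : ℂ)) (fun x : (quasiSplit (↥(maximalRealSubfield L)) L (IsCMField.complexConj L) 2).Adelic => ((η i (adelicVal (↥(maximalRealSubfield L)) L (IsCMField.complexConj L) 2 ((StdForm.antidiagonal 2).over L) x) : ℝ) : ℂ)) y) i y).re : ℝ)) : ℂ) * u (g * y)) νG ∧ Λ (toHX (↥(maximalRealSubfield L)) L (IsCMField.complexConj L) 2 (n + 3) μ u hu) = ∫ y, (((((fun (i : I) (y : (quasiSplit (↥(maximalRealSubfield L)) L (IsCMField.complexConj L) 2).Adelic) => orbitalSmoothing νG (fun x : (quasiSplit (↥(maximalRealSubfield L)) L (IsCMField.complexConj L) 2).Adelic => ((η i (adelicVal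 (↥(maximalRealSubfield L)) L (IsCMField.complexConj L) 2 ((StdForm.antidiagonal 2).over L) x) : ℝ) : ℂ)) (fun x : (quasiSplit (↥(maximalRealSubfield L)) L (IsCMField.complexConj L) 2).Adelic => ((η i (adelicVal (↥(maximalRealSubfield L)) L (IsCMField.complexConj L) 2 ((StdForm.antidiagonal 2).over L) x) : ℝ) : ℂ)) y) i y).re : ℝ)) : ℂ) * u (g * y) ∂νG :=
      fun i => exists_evalCLM μ νG (n + 3) (h := fun x => ((fun (i : I) (y : (quasiSplit (↥(maximalRealSubfield L)) L (IsCMField.complexConj L) 2).Adelic) => orbitalSmoothing νG (fun x : (quasiSplit (↥(maximalRealSubfield L)) L (IsCMField.complexConj L) 2).Adelic => ((η i (adelicVal (↥(maximalRealSubfield L)) L (IsCMField.complexConj L) 2 ((StdForm.antidiagonal 2).over L) x) : ℝ) : ℂ)) (fun x : (quasiSplit (↥(maximalRealSubfield L)) L (IsCMField.complexConj L) 2).Adelic => ((η i (adelicVal (↥(maximalRealSubfield L)) L (IsCMField.complexConj L) 2 ((StdForm.antidiagonal 2).over L) x) : ℝ) : ℂ)) y) i x).re) (Complex.continuous_re.comp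 (hconv i).1) ((hconv i).2.1.comp_left Complex.zero_re) g
    choose Λ hΛ using hΛex
    have hΛu : ∀ j (u : (quasiSplit (↥(maximalRealSubfield L)) L (IsCMField.complexConj L) 2).Adelic → ℂ) (huG : ∀ γ ∈ (quasiSplit (↥(maximalRealSubfield L)) L (IsCMField.complexConj L) 2).quotientSubgroup, ∀ y, u (γ * y) = u y) (hu : MemLp ((quasiSplit (↥(maximalRealSubfield L)) L (IsCMField.complexConj L) 2).quotFun u) 2 (μ.withDensity fun x => (((supHeight (↥(maximalRealSubfield L)) L (IsCMField.complexConj L) 2 x)⁻¹ ^ (2 * (n + 3)) : ℝ≥0) : ℝ≥0∞))),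
        Λ j (toHX (↥(maximalRealSubfield L)) L (IsCMField.complexConj L) 2 (n + 3) μ u hu) = ∫ y, (fun (i : I) (y : (quasiSplit (↥(maximalRealSubfield L)) L (IsCMField.complexConj L) 2).Adelic) => orbitalSmoothing νG (fun x : (quasiSplit (↥(maximalRealSubfield L)) L (IsCMField.complexConj L) 2).Adelic => ((η i (adelicVal (↥(maximalRealSubfield L)) L (IsCMField.complexConj L) 2 ((StdForm.antidiagonal 2).over L) x) : ℝ) : ℂ)) (fun x : (quasiSplit (↥(maximalRealSubfield L)) L (IsCMField.complexConj L) 2).Adelic => ((η i (adelicVal (↥(maximalRealSubfield L)) L (IsCMField.complexConj L) 2 ((StdForm.antidiagonal 2).over L) x) : ℝ) : ℂ)) y) j y * u (g * y) ∂νG := fun j u huG hu => by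
      rw [(hΛ j u huG hu).2]
      simp only [hre]
    -- the Eisenstein specialisation `Λ_j [E(φ₀H^z)] = ĥ_j(z)·E(φ₀H^z)(g)` on the Godement part of the ball (★ `hHecke_cm_two`)
    have hinv : ∀ z : ℂ, ∀ γ ∈ (quasiSplit (↥(maximalRealSubfield L)) L (IsCMField.complexConj L) 2).quotientSubgroup, ∀ y, eisensteinSeriesU (flatSectionU (fun _ : (quasiSplit (↥(maximalRealSubfield L)) L (IsCMField.complexConj L) 2).Adelic => φ₀) z) (γ * y) = eisensteinSeriesU (flatSectionU (fun _ : (quasiSplit (↥(maximalRealSubfield L)) L (IsCMField.complexConj L) 2).Adelic => φ₀) z) y := by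
      intro z γ hγ y
      rw [quotientSubgroup_quasiSplit] at hγ
      obtain ⟨γ', hγ'⟩ := MonoidHom.mem_range.1 hγ
      rw [← hγ']
      exact eisensteinSeriesU_flatSectionU_rational_mul (φ := fun _ : (quasiSplit (↥(maximalRealSubfield L)) L (IsCMField.complexConj L) 2).Adelic => φ₀) (fun _ _ _ => rfl) z γ' y
    have hΛ' : ∀ i, ∀ z ∈ Metric.ball (0 : ℂ) (n + 2), 1 < z.re → Λ i (eX z) = (∫ x, (fun (i : I) (y : (quasiSplit (↥(maximalRealSubfield L)) L (IsCMField.complexConj L) 2).Adelic) => orbitalSmoothing νG (fun x : (quasiSplit (↥(maximalRealSubfield L)) L (IsCMField.complexConj L) 2).Adelic => ((η i (adelicVal (↥(maximalRealSubfield L)) L (IsCMField.complexConj L) 2 ((StdForm.antidiagonal 2).over L) x) : ℝ) : ℂ)) (fun x : (quasiSplit (↥(maximalRealSubfield L)) L (IsCMField.complexConj L) 2).Adelic => ((η i (adelicVal (↥(maximalRealSubfield L)) L (IsCMField.complexConj L) 2 ((StdForm.antidiagonal 2).over L) x) : ℝ) : ℂ)) y) i x * (((borelHeight x : ℝ≥0)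 : ℝ) : ℂ) ^ z ∂νG) * eisensteinSeriesU (flatSectionU (fun _ : (quasiSplit (↥(maximalRealSubfield L)) L (IsCMField.complexConj L) 2).Adelic => φ₀) z) g := by
      intro i z hz hz1
      rw [heXz z ⟨hz, hz1⟩, (hΛ i _ (hinv z) (hE z ⟨hz, hz1⟩)).2,
        hHecke_cm_two L νG (h := fun x => ((fun (i : I) (y : (quasiSplit (↥(maximalRealSubfield L)) L (IsCMField.complexConj L) 2).Adelic) => orbitalSmoothing νG (fun x : (quasiSplit (↥(maximalRealSubfield L)) L (IsCMField.complexConj L) 2).Adelic => ((η i (adelicVal (↥(maximalRealSubfield L)) L (IsCMField.complexConj L) 2 ((StdForm.antidiagonal 2).over L) x) : ℝ) : ℂ)) (fun x : (quasiSplit (↥(maximalRealSubfield L)) L (IsCMField.complexConj L) 2).Adelic => ((η i (adelicVal (↥(maximalRealSubfield L)) L (IsCMField.complexConj L) 2 ((StdForm.antidiagonal 2).over L) x) : ℝ) : ℂ)) y) i x).re) (fun k₀ hk₀ x => by simp only [(hconv i).2.2.1 k₀ hk₀ x]) (Complex.continuous_re.comp (hconv i).1)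
          ((hconv i).2.1.comp_left Complex.zero_re) φ₀ z hz1 g]
      simp only [hre]
    obtain ⟨Ec, hEcm, hEcg, hgerm, hord⟩ := hrepr (fun z => eisensteinSeriesU (flatSectionU (fun _ : (quasiSplit (↥(maximalRealSubfield L)) L (IsCMField.complexConj L) 2).Adelic => φ₀) z) g) Λ hΛ'
    -- the values `Λ_j (v_X s)` in integral form: `v_X s = toHX` of its canonical lift `y ↦ v_X(s)[y⁻¹]` (★ `quotFun_lift`, ★ `lift_quotientSubgroup_mul`)
    have hΛv : ∀ j s, Λ j (vX s) = ∫ y, (fun (i : I) (y : (quasiSplit (↥(maximalRealSubfield L)) L (IsCMField.complexConj L) 2).Adelic) => orbitalSmoothing νG (fun x : (quasiSplit (↥(maximalRealSubfield L)) L (IsCMField.complexConj L) 2).Adelic => ((η i (adelicVal (↥(maximalRealSubfield L)) L (IsCMField.complexConj L) 2 ((StdForm.antidiagonal 2).over L) x) : ℝ) : ℂ)) (fun x : (quasiSplit (↥(maximalRealSubfield L)) L (IsCMField.complexConj L) 2).Adelic => ((η i (adelicVal (↥(maximalRealSubfield L)) L (IsCMField.complexConj L) 2 ((StdForm.antidiagonal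 2).over L) x) : ℝ) : ℂ)) y) j y * ((vX s : HX (↥(maximalRealSubfield L)) L (IsCMField.complexConj L) 2 (n + 3) μ) : (quasiSplit (↥(maximalRealSubfield L)) L (IsCMField.complexConj L) 2).automorphicQuotient → ℂ) ((quasiSplit (↥(maximalRealSubfield L)) L (IsCMField.complexConj L) 2).toAutomorphicQuotient (g * y)⁻¹) ∂νG := by
      intro j s
      have hmem : MemLp ((quasiSplit (↥(maximalRealSubfield L)) L (IsCMField.complexConj L) 2).quotFun (fun y : (quasiSplit (↥(maximalRealSubfield L)) L (IsCMField.complexConj L) 2).Adelic => ((vX s : HX (↥(maximalRealSubfield L)) L (IsCMField.complexConj L) 2 (n + 3) μ) : (quasiSplit (↥(maximalRealSubfield L)) L (IsCMField.complexConj L) 2).automorphicQuotient → ℂ) ((quasiSplit (↥(maximalRealSubfield L)) L (IsCMField.complexConj L) 2).toAutomorphicQuotient y⁻¹))) 2 (μ.withDensity fun x => (((supHeight (↥(maximalRealSubfield L)) L (IsCMField.complexConj L) 2 x)⁻¹ ^ (2 * (n + 3)) : ℝ≥0) : ℝ≥0∞)) := by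
        rw [quotFun_lift]; exact Lp.memLp (vX s)
      have htoHX : toHX (↥(maximalRealSubfield L)) L (IsCMField.complexConj L) 2 (n + 3) μ (fun y : (quasiSplit (↥(maximalRealSubfield L)) L (IsCMField.complexConj L) 2).Adelic => ((vX s : HX (↥(maximalRealSubfield L)) L (IsCMField.complexConj L) 2 (n + 3) μ) : (quasiSplit (↥(maximalRealSubfield L)) L (IsCMField.complexConj L) 2).automorphicQuotient → ℂ) ((quasiSplit (↥(maximalRealSubfield L)) L (IsCMField.complexConj L) 2).toAutomorphicQuotient y⁻¹)) hmem = vX s := by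
        have key : ∀ (f : (quasiSplit (↥(maximalRealSubfield L)) L (IsCMField.complexConj L) 2).automorphicQuotient → ℂ) (hf : MemLp f 2 (μ.withDensity fun x => (((supHeight (↥(maximalRealSubfield L)) L (IsCMField.complexConj L) 2 x)⁻¹ ^ (2 * (n + 3)) : ℝ≥0) : ℝ≥0∞))), f = ((vX s : HX (↥(maximalRealSubfield L)) L (IsCMField.complexConj L) 2 (n + 3) μ) : (quasiSplit (↥(maximalRealSubfield L)) L (IsCMField.complexConj L) 2).automorphicQuotient → ℂ) → hf.toLp f = vX s := by
          rintro f hf rfl; exact Lp.toLp_coeFn _ _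
        exact key _ hmem (quotFun_lift _)
      have e := hΛu j (fun y : (quasiSplit (↥(maximalRealSubfield L)) L (IsCMField.complexConj L) 2).Adelic => ((vX s : HX (↥(maximalRealSubfield L)) L (IsCMField.complexConj L) 2 (n + 3) μ) : (quasiSplit (↥(maximalRealSubfield L)) L (IsCMField.complexConj L) 2).automorphicQuotient → ℂ) ((quasiSplit (↥(maximalRealSubfield L)) L (IsCMField.complexConj L) 2).toAutomorphicQuotient y⁻¹)) (lift_quotientSubgroup_mul _) hmem
      rw [htoHX] at e
      exact e
    exact ⟨Ec, hEcm, hEcg, hord, fun j z hz hne => (hgerm j z hz hne).trans (Filter.Eventually.of_forall fun s => by simp only [hΛv])⟩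

end Summit.HodgeConjecture.HodgeConjecture.Cruxes.H413.K2E1SphericalEisensteinMeromorphicExportsU2Unique

end
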